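import Mathlib

/-!
# The numbers of the dominant-term argument: unequal weights and the exponent condition (support, seat p1)

Two arithmetic facts needed to instantiate `T7SupportArchDecayGlue.a_bound_of_two_places` and the exponent
condition `β + d′ < α` of `T7SupportDominantGeometricSide.DominantSide` with the line's numbers:

* `rpow_neg_le_rpow_neg_of_le`: for `κ ≥ 1` and `α ≤ α′`, `κ^{−α′} ≤ κ^{−α}` — a decay of exponent `k′/2` at the
  place of the higher weight `k′` is a decay of the common exponent `α = k/2` (`decay_of_weight_ge`: from
  `‖a γ‖ ≤ C κ(γ)^{−k′/2}` to `‖a γ‖ ≤ C κ(γ)^{−k/2}` for `k ≤ k′`, `C ≥ 0`);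
* `exponent_condition`: with `α = 3/2` (weight `3`), a count exponent `β = 1 + ε` and a finite-factor growth
  exponent `d′ = ε`, the condition `β + d′ < α` holds exactly when `ε < 1/4`
  (`exponent_condition_iff`), in particular for `ε = 1/8` (`exponent_condition_eighth`); with `d′ = 0` it holds
  for `ε < 1/2` (`exponent_condition_of_d_zero`).

Nothing here is about any group or any period.
Blind lane: Mathlib only; no sorry; axioms ⊆ {propext, Classical.choice, Quot.sound}.
-/

namespace Summit.Ventures.HodgeRepro2.T7SupportExponentNumbers

/-- `κ^{−α′} ≤ κ^{−α}` for `κ ≥ 1` and `α ≤ α′` -/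
theorem rpow_neg_le_rpow_neg_of_le {κ α α' : ℝ} (hκ : 1 ≤ κ) (h : α ≤ α') : κ ^ (-α') ≤ κ ^ (-α) :=
  Real.rpow_le_rpow_of_exponent_le hκ (by linarith)

/-- **a decay of a higher exponent is a decay of a lower one**: `‖a γ‖ ≤ C κ(γ)^{−k′/2}` with `k ≤ k′` gives
`‖a γ‖ ≤ C κ(γ)^{−k/2}` (`κ ≥ 1`, `C ≥ 0`). -/
theorem decay_of_weight_ge {Orb : Type*} (a : Orb → ℂ) (κ : Orb → ℝ) (hκ : ∀ γ, 1 ≤ κ γ) {C : ℝ}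
    (hC : 0 ≤ C) {k k' : ℕ} (hkk' : k ≤ k') (h : ∀ γ, ‖a γ‖ ≤ C * κ γ ^ (-((k' : ℝ) / 2))) :
    ∀ γ, ‖a γ‖ ≤ C * κ γ ^ (-((k : ℝ) / 2)) := by
  intro γ
  refine (h γ).trans (mul_le_mul_of_nonneg_left ?_ hC)
  refine rpow_neg_le_rpow_neg_of_le (hκ γ) ?_
  have : (k : ℝ) ≤ k' := by exact_mod_cast hkk'
  linarith

/-- the exponent condition `(1 + ε) + ε < 3/2` holds iff `ε < 1/4` -/
theorem exponent_condition_iff (ε : ℝ) : (1 + ε) + ε < 3 / 2 ↔ ε < 1 / 4 := by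
  constructor <;> intro h <;> linarith

/-- the exponent condition with `ε = 1/8` -/
theorem exponent_condition_eighth : (1 + (1 / 8 : ℝ)) + 1 / 8 < 3 / 2 := by norm_num

/-- with `d′ = 0` the condition `(1 + ε) + 0 < 3/2` holds iff `ε < 1/2` -/
theorem exponent_condition_of_d_zero (ε : ℝ) : (1 + ε) + 0 < 3 / 2 ↔ ε < 1 / 2 := by
  constructor <;> intro h <;> linarith

/-- the general form: `β + d′ < α` for `β = 1 + ε`, `d′ = ε`, `α = k/2`, `k ≥ 3`, `ε < 1/4` -/
theorem exponent_condition_of_weight {k : ℕ} (hk : 3 ≤ k) {ε : ℝ} (hε : ε < 1 / 4) :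
    (1 + ε) + ε < (k : ℝ) / 2 := by
  have : (3 : ℝ) ≤ k := by exact_mod_cast hk
  linarith

end Summit.Ventures.HodgeRepro2.T7SupportExponentNumbers
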